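import Summits.ResolutionOfSingularities.ResolutionOfSingularities.Theorems.HilbertSamuelEliminationSigmaMaxModificationsCorridor3WLadderIsoInsepTailCutDefs
import Summits.ResolutionOfSingularities.ResolutionOfSingularities.Theorems.HilbertSamuelEliminationSigmaMaxModificationsCorridor3WLadderIsoTailsHSTower
import Summits.ResolutionOfSingularities.ResolutionOfSingularities.Theorems.HilbertSamuelEliminationSigmaMaxModificationsCorridor3WLadderIsoTailTower
import Literature.RingTheory.CompleteLocalRings.CotangentPresentation
import Literature.RingTheory.CompleteLocalRings.CoefficientField
import Literature.RingTheory.MvPowerSeries.MaximalIdealPow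
import Literature.RingTheory.HilbertSamuel.HilbertSamuelCompletion
import Literature.AlgebraicGeometry.Resolution.PowerSeriesRegularLocal
import Mathlib.RingTheory.AdicCompletion.LocalRing
import HarnessLib

/-!
# [OURS · L1 W4.2] k2 row `IsoDoublePointPropagates₂` — a FORMAL DOUBLE POINT IS READ OFF THE HILBERT FUNCTION, hence propagates along
# every isolated point tower (crux chain w42, cell k2 `T3insep` at `p = 2`; `--supports stmt-ResolutionOfSingularities-19249`)

OURS (cell res-hironaka, slot W4.2, seat res-D-pv-042; OWN OBJECT TUO 14:54Z); NOT a statement of [Hironaka2017] nor of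
[CossartJannsenSaito2020] / [Matsumura1987]. AI-drafted, weaker than expert review. PROOF file, def-free, fact-free.

* §1 `hilbertFun_eq_of_ringEquiv_quotient_order_two` — if `C ≅ κ⟦x,y,z,w⟧/(F)` with `ord F = 2` then `H⁽⁰⁾(C) = hypersurfaceHFe 4 2`
  (Singh's formula `Helpers.hilbertFun_quotient_span_singleton`).
* §2 `exists_ringEquiv_quotient_order_two_of_hilbertFun_eq` — conversely, a COMPLETE noetherian local ring `C` containing a field with
  `H⁽⁰⁾(C) = hypersurfaceHFe 4 2` is `≅ K⟦x,y,z,w⟧/(F)` with `ord F = 2`, `K` its residue field: Cohen coefficient field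
  (`CompleteLocalRings.exists_ringHom_comp_residue_eq_id`), the cotangent presentation `K⟦X₁,…,X₄⟧ ↠ C` on `4 = H⁽⁰⁾(C)(1)` generators
  (`CompleteLocalRings.exists_mvPowerSeries_algHom_surjective_of_le_sup_sq`), and the tame line's H1 `Helpers.stub_H1_hypersurface_of_hilbertFun`
  (a surjection from a regular local ring of dimension `e` onto a ring with Hilbert function `hypersurfaceHFe e m` has principal kernel
  generated by an element of order exactly `m`).
* §3 `isFormalDoublePointAt_succ_of_isIsoPointTower` — along an isolated E3 point tower over a maximal origin of characteristic two the
  Hilbert functions of the local rings do not move (res-type-001's H3 `IsoTailsHS.hilbertSamuelFun_stalk_eq_of_isIsoPointTower`), and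
  `H⁽⁰⁾(𝒪̂) = H⁽⁰⁾(𝒪)`; so a formal double point of embedding dimension four (`IdeasL1C6.IsFormalDoublePointAt`) at stage `n` forces one at
  stage `n + 1` — and at every later stage (`isFormalDoublePointAt_of_le_of_isIsoPointTower`); **`isoDoublePointPropagates₂_holds : ∀ N,
  IsoDoublePointPropagates₂ N`** — the OURS row of k2 PART 3a (`…Corridor3WLadderIsoInsepTailCutDefs`, p540282; res-L1-w42-idea-1 Sketch C10 §2:
  «dictionary only») IS A THEOREM.
-/

noncomputable section

set_option linter.dupNamespace false

open scoped Classical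
open CategoryTheory AlgebraicGeometry TopologicalSpace IsLocalRing MvPowerSeries
open Literature.AlgebraicGeometry.Resolution Literature.RingTheory.HilbertSamuel
open Literature.AlgebraicGeometry.CossartJannsenSaito2020
open Summit.ResolutionOfSingularities.ResolutionOfSingularities.Theorems.CampaignW42
open Summit.ResolutionOfSingularities.ResolutionOfSingularities.Theorems.SigmaMaxModificationsCorridor3
open Summit.ResolutionOfSingularities.ResolutionOfSingularities.Theorems.SigmaMaxModificationsCorridor3.Helpers
  (hypersurfaceHFe hypersurfaceHFe_apply hilbertFun_quotient_span_singleton stub_H1_hypersurface_of_hilbertFun)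
open Summit.ResolutionOfSingularities.ResolutionOfSingularities.Cruxes.SigmaMaxModifications.IdeasL1Idea2R4 (IsIsoPointTower)

namespace Summit.ResolutionOfSingularities.ResolutionOfSingularities.Cruxes.SigmaMaxModifications.IdeasL1C6

universe u v

/-! ## §1. The Hilbert function of a formal double point -/

section Forward

variable {κ : Type u} [Field κ]

/-- `κ⟦X₁,…,X₄⟧` has embedding dimension `4`. [folklore] -/
theorem spanFinrank_maximalIdeal_mvPowerSeries_fin_four :
    (maximalIdeal (MvPowerSeries (Fin 4) κ)).spanFinrank = 4 := by
  haveI : IsRegularLocalRing (MvPowerSeries (Fin 4) κ) := (isRegularLocalRing_mvPowerSeries_fin κ 4).1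
  have h := IsRegularLocalRing.spanFinrank_maximalIdeal (R := MvPowerSeries (Fin 4) κ)
  rw [(isRegularLocalRing_mvPowerSeries_fin κ 4).2] at h
  exact_mod_cast h

/-- `ord F = 2` iff `F ∈ 𝔪² ∖ 𝔪³`. [folklore] -/
theorem order_eq_two_iff (F : MvPowerSeries (Fin 4) κ) :
    F.order = 2 ↔ F ∈ maximalIdeal (MvPowerSeries (Fin 4) κ) ^ 2 ∧ F ∉ maximalIdeal (MvPowerSeries (Fin 4) κ) ^ 3 := by
  rw [← Literature.RingTheory.MvPowerSeries.Jets.le_order_iff_mem_maximalIdeal_pow,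
    ← Literature.RingTheory.MvPowerSeries.Jets.le_order_iff_mem_maximalIdeal_pow]
  constructor
  · intro h
    rw [h]
    exact ⟨le_rfl, by decide⟩
  · rintro ⟨h2, h3⟩
    rw [not_le] at h3
    have hlt : F.order < ⊤ := lt_of_lt_of_le h3 le_top
    obtain ⟨o, ho⟩ := ENat.ne_top_iff_exists.mp hlt.ne
    rw [← ho] at h2 h3 ⊢
    have h2' : 2 ≤ o := by exact_mod_cast h2
    have h3' : o < 3 := by exact_mod_cast h3
    have : o = 2 := by omega
    rw [this]; rfl

/-- **§1.** A local ring isomorphic to `κ⟦x,y,z,w⟧/(F)` with `ord F = 2` has Hilbert function `hypersurfaceHFe 4 2` (Singh). [folklore] -/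
theorem hilbertFun_eq_of_ringEquiv_quotient_order_two {C : Type v} [CommRing C] [IsLocalRing C] [IsNoetherianRing C]
    {F : MvPowerSeries (Fin 4) κ} (hF : F.order = 2) (e : C ≃+* MvPowerSeries (Fin 4) κ ⧸ Ideal.span {F}) :
    hilbertFun C = hypersurfaceHFe 4 2 := by
  haveI : IsRegularLocalRing (MvPowerSeries (Fin 4) κ) := (isRegularLocalRing_mvPowerSeries_fin κ 4).1
  obtain ⟨hF2, hF3⟩ := (order_eq_two_iff F).mp hF
  have hF𝔪 : F ∈ maximalIdeal (MvPowerSeries (Fin 4) κ) := Ideal.pow_le_self two_ne_zero hF2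
  have hle : Ideal.span {F} ≤ maximalIdeal (MvPowerSeries (Fin 4) κ) := (Ideal.span_singleton_le_iff_mem _).mpr hF𝔪
  have hne : Ideal.span {F} ≠ (⊤ : Ideal (MvPowerSeries (Fin 4) κ)) :=
    ne_top_of_le_ne_top (maximalIdeal.isMaximal (MvPowerSeries (Fin 4) κ)).ne_top hle
  -- `S/(F)` is local (a non-trivial quotient of a local ring; instance `Literature.RingTheory.HilbertSamuel.isLocalRing_quotient`)
  haveI : Nontrivial (MvPowerSeries (Fin 4) κ ⧸ Ideal.span {F}) := Ideal.Quotient.nontrivial_iff.mpr hne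
  have h1 : hilbertFun C = hilbertFun (MvPowerSeries (Fin 4) κ ⧸ Ideal.span {F}) := hilbertFun_eq_of_ringEquiv e
  -- (named arguments: elaborating Singh's formula against an expected type unfolds `hypersurfaceHFe` and times out)
  have h2 := hilbertFun_quotient_span_singleton (R := MvPowerSeries (Fin 4) κ) (d := 4) (m := 2)
    spanFinrank_maximalIdeal_mvPowerSeries_fin_four hF2 hF3
  exact h1.trans h2

end Forward

/-! ## §2. A complete local ring with the Hilbert function of a double point IS a formal double point -/

section Backward

/-- `hypersurfaceHFe 4 2 1 = 4`. [folklore] -/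
theorem hypersurfaceHFe_four_two_one : hypersurfaceHFe 4 2 1 = 4 := by
  rw [hypersurfaceHFe_apply]; decide

/-- **§2.** A COMPLETE noetherian local ring containing a field whose Hilbert function is `hypersurfaceHFe 4 2` is isomorphic to
`K⟦x,y,z,w⟧/(F)` with `ord F = 2`, `K` its residue field (Cohen coefficient field + cotangent presentation on four generators + the tame
line's H1). [folklore] -/
theorem exists_ringEquiv_quotient_order_two_of_hilbertFun_eq (C : Type u) [CommRing C] [IsLocalRing C] [IsNoetherianRing C]
    [IsAdicComplete (maximalIdeal C) C] (k : Type v) [Field k] [Algebra k C] (hH : hilbertFun C = hypersurfaceHFe 4 2) :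
    ∃ F : MvPowerSeries (Fin 4) (ResidueField C), F.order = 2 ∧
      Nonempty (C ≃+* MvPowerSeries (Fin 4) (ResidueField C) ⧸ Ideal.span {F}) := by
  -- a coefficient field
  obtain ⟨σ, hσ⟩ := Literature.RingTheory.CompleteLocalRings.exists_ringHom_comp_residue_eq_id C k
  set K := ResidueField C with hK
  letI : Algebra K C := σ.toAlgebra
  have halg : ∀ x : K, algebraMap K C x = σ x := fun _ => rfl
  haveI : IsAdicComplete (maximalIdeal K) K := by
    rw [(IsLocalRing.isField_iff_maximalIdeal_eq).mp (Field.toIsField K)]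
    infer_instance
  haveI : IsLocalHom (algebraMap K C) := by
    refine ⟨fun a ha => ?_⟩
    rcases eq_or_ne a 0 with rfl | hne
    · rw [map_zero] at ha
      exact absurd ha not_isUnit_zero
    · exact hne.isUnit
  have hres : ∀ c : C, ∃ l : K, c - algebraMap K C l ∈ maximalIdeal C := by
    intro c
    refine ⟨residue C c, ?_⟩
    rw [← IsLocalRing.residue_eq_zero_iff, map_sub, halg, hσ, sub_self]
  -- four generators of `𝔪_C`
  have hfin : (maximalIdeal C).spanFinrank = 4 := by
    rw [IsLocalRing.spanFinrank_maximalIdeal_eq_finrank_cotangentSpace, ← hilbertFun_one, hH, hypersurfaceHFe_four_two_one]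
  obtain ⟨s, hscard, hsspan⟩ :=
    Submodule.FG.exists_span_finset_card_eq_spanFinrank (maximalIdeal C).fg_of_isNoetherianRing
  rw [hfin] at hscard
  let ε : s ≃ Fin 4 := s.equivFinOfCardEq hscard
  let x : Fin 4 → C := fun i => (ε.symm i : C)
  have hxrange : Set.range x = (s : Set C) := by
    ext c
    constructor
    · rintro ⟨i, rfl⟩
      exact (ε.symm i).2
    · intro hc
      exact ⟨ε ⟨c, hc⟩, by simp [x]⟩
  have hxspan : Ideal.span (Set.range x) = maximalIdeal C := by
    rw [hxrange]; exact hsspan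
  have hxm : ∀ i, x i ∈ maximalIdeal C := fun i => by
    rw [← hxspan]; exact Ideal.subset_span ⟨i, rfl⟩
  have hgen : maximalIdeal C ≤ Ideal.span (Set.range x) ⊔ (maximalIdeal K).map (algebraMap K C) ⊔ maximalIdeal C ^ 2 := by
    rw [hxspan]; exact le_sup_left.trans le_sup_left
  obtain ⟨Θ, hΘ, -⟩ :=
    Literature.RingTheory.CompleteLocalRings.exists_mvPowerSeries_algHom_surjective_of_le_sup_sq hres x hxm hgen
  -- H1: the kernel is principal, generated by an element of order exactly `2`
  set S := MvPowerSeries (Fin 4) K with hS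
  haveI : IsRegularLocalRing S := (isRegularLocalRing_mvPowerSeries_fin K 4).1
  have hdimS : ringKrullDim S = (4 : ℕ) := (isRegularLocalRing_mvPowerSeries_fin K 4).2
  obtain ⟨g, hker, hg2, hg3⟩ := stub_H1_hypersurface_of_hilbertFun Θ.toRingHom hΘ hdimS le_rfl hH
  refine ⟨g, (order_eq_two_iff g).mpr ⟨hg2, hg3⟩, ⟨?_⟩⟩
  exact ((RingHom.quotientKerEquivOfSurjective hΘ).symm).trans (Ideal.quotEquivOfEq hker)

end Backward

/-! ## §3. Propagation along an isolated point tower -/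

section Tower

open Summit.ResolutionOfSingularities.ResolutionOfSingularities.Theorems.SigmaMaxModificationsCorridor3.Moving (exists_towerStructure)

/-- The stalk of a scheme over a field `k` is a `k`-algebra (through the global sections). [folklore] -/
theorem exists_ringHom_field_stalk {k : Type u} [Field k] {X : Scheme.{u}} (f : X ⟶ Spec (.of k)) (x : X) :
    Nonempty (k →+* X.presheaf.stalk x) :=
  ⟨(X.presheaf.germ ⊤ x trivial).hom.comp ((f.appTop).hom.comp (Scheme.ΓSpecIso (.of k)).inv.hom)⟩

/-- **A formal double point is read off the Hilbert function** (scheme form): for a point `x` of a locally noetherian scheme over a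
field, `IsFormalDoublePointAt X x ↔ H⁽⁰⁾(𝒪_{X,x}) = hypersurfaceHFe 4 2`. [OURS · L1 W4.2 · k2] [folklore] -/
theorem isFormalDoublePointAt_iff_hilbertFun_eq {k : Type u} [Field k] {X : Scheme.{u}} (f : X ⟶ Spec (.of k))
    [IsLocallyNoetherian X] (x : X) :
    IsFormalDoublePointAt X x ↔ hilbertFun (X.presheaf.stalk x) = hypersurfaceHFe 4 2 := by
  set A := X.presheaf.stalk x with hA
  haveI : IsNoetherianRing (AdicCompletion (maximalIdeal A) A) := isNoetherianRing_adicCompletion_maximalIdeal A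
  constructor
  · rintro ⟨κ, _, F, hF, ⟨e⟩⟩
    rw [← hilbertFun_adicCompletion A]
    exact hilbertFun_eq_of_ringEquiv_quotient_order_two hF e
  · intro hH
    obtain ⟨φ⟩ := exists_ringHom_field_stalk f x
    letI : Algebra k (AdicCompletion (maximalIdeal A) A) :=
      ((algebraMap A (AdicCompletion (maximalIdeal A) A)).comp φ).toAlgebra
    haveI : IsAdicComplete (maximalIdeal (AdicCompletion (maximalIdeal A) A)) (AdicCompletion (maximalIdeal A) A) :=
      AdicCompletion.isAdicComplete_of_fg (maximalIdeal A).fg_of_isNoetherianRing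
    have hH' : hilbertFun (AdicCompletion (maximalIdeal A) A) = hypersurfaceHFe 4 2 := by
      rw [hilbertFun_adicCompletion A, hH]
    obtain ⟨F, hF, ⟨e⟩⟩ := exists_ringEquiv_quotient_order_two_of_hilbertFun_eq (AdicCompletion (maximalIdeal A) A) k hH'
    exact ⟨ResidueField (AdicCompletion (maximalIdeal A) A), inferInstance, F, hF, ⟨e⟩⟩

/-- **§3. Propagation.** Along an isolated E3 point tower over a maximal origin of characteristic two, a formal double point of
embedding dimension four at stage `n` is followed by one at stage `n + 1`: the Hilbert functions of the local rings do not move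
(res-type-001's `IsoTailsHS.hilbertSamuelFun_stalk_eq_of_isIsoPointTower`) and a formal double point is read off the Hilbert function.
[OURS · L1 W4.2 · k2 · row `IsoDoublePointPropagates₂` unfolded] [folklore] -/
theorem isFormalDoublePointAt_succ_of_isIsoPointTower {N : ℕ} {ν : ℕ → ℕ} {T : BlowupTower.{u}} {pt : ∀ n, T.X n}
    (hO : IsMaximalOrigin 2 N ν (T.X 0) (pt 0)) (hT : IsIsoPointTower N ν T pt) (n : ℕ)
    (hn : IsFormalDoublePointAt (T.X n) (pt n)) : IsFormalDoublePointAt (T.X (n + 1)) (pt (n + 1)) := by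
  obtain ⟨k, _, _, f₀, hsep, hft, hqc⟩ := hO.exists_structure
  haveI := hsep
  haveI := hft
  haveI := hqc
  obtain ⟨f, -, -, -⟩ := exists_towerStructure T f₀
  haveI : IsLocallyNoetherian (T.X n) := T.ln n
  haveI : IsLocallyNoetherian (T.X (n + 1)) := T.ln (n + 1)
  rw [isFormalDoublePointAt_iff_hilbertFun_eq (f n)] at hn
  rw [isFormalDoublePointAt_iff_hilbertFun_eq (f (n + 1))]
  have h1 := IsoTailsHS.hilbertSamuelFun_stalk_eq_of_isIsoPointTower hO hT (n + 1) 0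
  have h2 := IsoTailsHS.hilbertSamuelFun_stalk_eq_of_isIsoPointTower hO hT n 0
  simp only [hilbertSamuelFun_zero] at h1 h2
  rw [h1, ← h2, hn]

/-- **Corollary.** Hence a formal double point at stage `n₀` is followed by formal double points at every stage `n ≥ n₀`.
[OURS · L1 W4.2 · k2] [folklore] -/
theorem isFormalDoublePointAt_of_le_of_isIsoPointTower {N : ℕ} {ν : ℕ → ℕ} {T : BlowupTower.{u}} {pt : ∀ n, T.X n}
    (hO : IsMaximalOrigin 2 N ν (T.X 0) (pt 0)) (hT : IsIsoPointTower N ν T pt) {n₀ n : ℕ} (hle : n₀ ≤ n)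
    (h₀ : IsFormalDoublePointAt (T.X n₀) (pt n₀)) : IsFormalDoublePointAt (T.X n) (pt n) := by
  induction n, hle using Nat.le_induction with
  | base => exact h₀
  | succ n _ ih => exact isFormalDoublePointAt_succ_of_isIsoPointTower hO hT n ih

/-- **THE ROW `IsoDoublePointPropagates₂` IS A THEOREM** (k2 PART 3a, `…Corridor3WLadderIsoInsepTailCutDefs`, res-L1-w42-idea-1 Sketch C10 §2
«support · Hilbert–Samuel constancy»): along an isolated E3 point tower over a maximal origin of characteristic two a formal double point of
embedding dimension four is followed by one.  [OURS · L1 W4.2 · k2 · PROVED] [folklore] -/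
theorem isoDoublePointPropagates₂_holds (N : ℕ) : IsoDoublePointPropagates₂.{u} N :=
  fun _ν _T _pt hO hT n hn => isFormalDoublePointAt_succ_of_isIsoPointTower hO hT n hn

/-! ### Appendix (append-only, same seat): the dichotomy at the origin and the k2 joins with `hD` discharged -/

open Summit.ResolutionOfSingularities.ResolutionOfSingularities.Cruxes.SigmaMaxModifications.IdeasL1C5 (IsInsepStage IsoInsepTowerTerminates)

/-- **Dichotomy at the origin.** Along an isolated E3 point tower over a maximal origin of characteristic two, being a formal double point
of embedding dimension four is decided at stage `0`: `IsFormalDoublePointAt (T.X n) (pt n) ↔ IsFormalDoublePointAt (T.X 0) (pt 0)` for every `n`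
(the Hilbert functions of all the stalks coincide).  Consequence for the E-cut of `T3insep` (k2 PART 2′): the rows E0/E1/E2-rec concern exactly
the towers over a formal-double-point ORIGIN, and k2c (`IsoInsepNonDoubleRecurrentImpossible₂`) exactly the towers whose origin is NOT one —
no tower mixes the two kinds of stages. [OURS · L1 W4.2 · k2 · PROVED] [folklore] -/
theorem isFormalDoublePointAt_iff_origin_of_isIsoPointTower {N : ℕ} {ν : ℕ → ℕ} {T : BlowupTower.{u}} {pt : ∀ n, T.X n}
    (hO : IsMaximalOrigin 2 N ν (T.X 0) (pt 0)) (hT : IsIsoPointTower N ν T pt) (n : ℕ) :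
    IsFormalDoublePointAt (T.X n) (pt n) ↔ IsFormalDoublePointAt (T.X 0) (pt 0) := by
  obtain ⟨k, _, _, f₀, hsep, hft, hqc⟩ := hO.exists_structure
  haveI := hsep
  haveI := hft
  haveI := hqc
  obtain ⟨f, -, -, -⟩ := exists_towerStructure T f₀
  haveI : IsLocallyNoetherian (T.X n) := T.ln n
  haveI : IsLocallyNoetherian (T.X 0) := T.ln 0
  rw [isFormalDoublePointAt_iff_hilbertFun_eq (f n), isFormalDoublePointAt_iff_hilbertFun_eq (f 0)]
  have h := IsoTailsHS.hilbertSamuelFun_stalk_eq_of_isIsoPointTower hO hT n 0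
  simp only [hilbertSamuelFun_zero] at h
  rw [h]

/-- **k2c sharpened.** Hence an isolated E3 point tower over a maximal origin of characteristic two has a NON-double-point stage iff its
origin is not a formal double point, in which case NO stage is one: the k2c row `IsoInsepNonDoubleRecurrentImpossible₂ N` is equivalent to
«no isolated E3 point tower over a maximal origin of characteristic two that is NOT a formal double point of embedding dimension four has
inseparable stages infinitely often». [OURS · L1 W4.2 · k2 · PROVED] [folklore] -/
theorem isoInsepNonDoubleRecurrentImpossible₂_iff (N : ℕ) :
    IsoInsepNonDoubleRecurrentImpossible₂.{u} N ↔
      ∀ (ν : ℕ → ℕ) (T : BlowupTower.{u}) (pt : ∀ n, T.X n), IsMaximalOrigin 2 N ν (T.X 0) (pt 0) → IsIsoPointTower N ν T pt →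
        ¬ IsFormalDoublePointAt (T.X 0) (pt 0) → ¬ ∀ n₀, ∃ n, n₀ ≤ n ∧ IsInsepStage T pt n := by
  constructor
  · intro h ν T pt hO hT h0 hrec
    exact h ν T pt hO hT fun n₀ => by
      obtain ⟨n, hn, hins⟩ := hrec n₀
      exact ⟨n, hn, hins, fun hd => h0 ((isFormalDoublePointAt_iff_origin_of_isIsoPointTower hO hT n).mp hd)⟩
  · intro h ν T pt hO hT hrec
    obtain ⟨n, -, -, hnd⟩ := hrec 0
    have h0 : ¬ IsFormalDoublePointAt (T.X 0) (pt 0) := fun hd =>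
      hnd ((isFormalDoublePointAt_iff_origin_of_isIsoPointTower hO hT n).mpr hd)
    exact h ν T pt hO hT h0 fun n₀ => by
      obtain ⟨m, hm, hins, -⟩ := hrec n₀
      exact ⟨m, hm, hins⟩

/-- **The k2 joins with `hD` discharged (1).** E2-propagation from E0, E1 and NO-JUMP alone (`isoInsepE2Propagates₂_of_noJump` with the
proved propagation row). [OURS · L1 W4.2 · k2 · PROVED] -/
theorem isoInsepE2Propagates₂_of_noJump' {N : ℕ} (h0 : IsoInsepE0Impossible₂.{u} N) (h1 : IsoInsepE1Impossible₂.{u} N)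
    (hJ : IsoInsepE2SuccInsep₂.{u} N) : IsoInsepE2Propagates₂.{u} N :=
  isoInsepE2Propagates₂_of_noJump h0 h1 hJ (isoDoublePointPropagates₂_holds N)

/-- **The k2 joins with `hD` discharged (2).** `E0 → E1 → NO-JUMP → (no E2 tail) → k2c → IsoInsepTowerTerminates 2 N`
(`isoInsepTowerTerminates₂_of_tail` with the proved propagation row). [OURS · L1 W4.2 · k2 · PROVED] -/
theorem isoInsepTowerTerminates₂_of_tail' {N : ℕ} (h0 : IsoInsepE0Impossible₂.{u} N) (h1 : IsoInsepE1Impossible₂.{u} N)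
    (hJ : IsoInsepE2SuccInsep₂.{u} N) (hT : IsoInsepE2TailImpossible₂.{u} N) (hc : IsoInsepNonDoubleRecurrentImpossible₂.{u} N) :
    IsoInsepTowerTerminates.{u} 2 N :=
  isoInsepTowerTerminates₂_of_tail h0 h1 hJ (isoDoublePointPropagates₂_holds N) hT hc

end Tower

end Summit.ResolutionOfSingularities.ResolutionOfSingularities.Cruxes.SigmaMaxModifications.IdeasL1C6

end
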